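/-
Copyright (c) 2026. All rights reserved.
Released under Apache 2.0 license as described in the file LICENSE.
Authors: abc-iut cell, prover seat abc-iut-L6-t14 (wave 2, generation 2).
-/
import Mathlib.RingTheory.MvPowerSeries.Evaluation
import Mathlib.RingTheory.MvPowerSeries.Trunc
import Mathlib.RingTheory.AdicCompletion.Topology
import HarnessLib

/-!
# Adic evaluation of formal power series at topologically nilpotent points

Topic `Literature/RingTheory/MvPowerSeries`. Let `A` be a commutative ring, complete and separated
for the `I`-adic topology (Mathlib's algebraic `IsAdicComplete I A`), and `x : τ → A` finitely many
elements of `I`. A formal power series `f = Σ_e f_e X^e ∈ A⟦X_s : s ∈ τ⟧` has a value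
`f(x) = Σ_e f_e x^e ∈ A`, the `I`-adically convergent sum of its terms (Bourbaki, *Algèbre* IV §4
no. 3; *Alg. Comm.* III §4 no. 5: "si `A` est séparé et complet … la famille `(a_ν x^ν)` est
sommable"). We name this value `adicEval I x f`; it is DEFINED as Mathlib's topological evaluation
`MvPowerSeries.eval₂` (Chambert-Loir–de Frutos-Fernández) for the `I`-adic topology
`Ideal.adicTopology I` on `A`, so that no topology has to be carried by the statements that use
it (the consumers — Hensel-type lemmas over complete local rings such as [AbsTopII] Lemma 2.1 —
are phrased with `IsAdicComplete`). Off the meaningful range (`x s ∉ I`, or `A` not complete)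
the value is Mathlib's junk value and nothing is claimed about it.

## Contents (all proved)

* `adicEval I x f`; on polynomials it is `MvPolynomial.eval x` (`adicEval_coe`, `adicEval_C`,
  `adicEval_X`), unconditionally.
* For `A` `I`-adically complete, `τ` finite and all `x s ∈ I`: `adicEvalHom` (evaluation is a ring
  homomorphism; `adicEval_add`, `adicEval_mul`, …); the TERMWISE CLOSED-IDEAL PRINCIPLE
  `adicEval_sub_adicEval_mem`: if `J ⊇ I^N` and every term `f_e x^e - g_e y^e ∈ J` then
  `f(x) - g(y) ∈ J` (ideals containing a power of `I` are closed); whence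
  `adicEval_mem_pow_of_coeff_eq_zero` (no terms of degree `< N` ⇒ `f(x) ∈ I^N`),
  `adicEval_sub_eval_truncTotal_mem_pow` (`f(x) ≡ (trunc_{<N} f)(x) mod I^N` — the
  characterisation by truncations), `adicEval_sub_adicEval_mem_of_sub_mem` (`x ≡ y ⇒ f(x) ≡ f(y)`),
  `adicEval_sub_adicEval_mem_pow_succ` (for `f` of order `≥ 2`: `x ≡ y mod I^r ⇒ f(x) ≡ f(y)
  mod I^{r+1}`), `adicEval_sub_constantCoeff_mem` (`f(x) ≡ f(0) mod I`),
  `adicEval_smul_eq_sq_mul` (the rescaling `f(d·z) = d² g(z)` when `f_e d^{|e|} = d² g_e`),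
  `eq_of_forall_sub_mem_pow` (separatedness), `ringHom_eq_adicEval` (uniqueness: a ring
  homomorphism that is evaluation on polynomials and continuous for the `(X)`-adic filtration is
  `adicEval`), and `map_adicEval` (compatibility with a ring
  homomorphism `φ : A → B` mapping `I` into `I'`, `B` being `I'`-adically complete:
  `φ (f(x)) = (φ f)(φ x)`).

## References

* N. Bourbaki, *Algèbre commutative*, Ch. III §4 no. 5, Prop. 6 (for `B` "satisfaisant aux
  conditions de Hensel" — e.g. `A` séparé et complet pour la topologie `𝔪`-adique — and `x` a
  family of topologically nilpotent elements there is a unique homomorphism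
  `ũ : A[[X₁,…,Xₙ]] → B` with `ũ(a) = u(a)`, `ũ(Xᵢ) = xᵢ`, continuous for the `(X)`-adic topology;
  notation `f(x)`), Cor. of Prop. 7 (`x ≡ x' (mod 𝔮) ⇒ f(x) ≡ f(x') (mod 𝔮)` for closed `𝔮`);
  Ch. III §2 no. 5 (separatedness). [Bourbaki1989CommAlg]
-/

noncomputable section

namespace Literature.RingTheory.MvPowerSeries

open _root_.MvPowerSeries

universe u v

variable {A : Type u} [CommRing A]

/-- **Adic evaluation** of a formal power series: for an ideal `I` of `A`, a point `x : τ → A` and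
`f ∈ A⟦X_s : s ∈ τ⟧`, `adicEval I x f = Σ_e f_e x^e` summed in the `I`-adic topology — Mathlib's
topological evaluation `MvPowerSeries.eval₂ (RingHom.id A) x f` for `Ideal.adicTopology I`.
Meaningful when `A` is `I`-adically complete, `τ` is finite and all `x s ∈ I` (Bourbaki: "nous
noterons `f(x₁, …, xₙ)` … l'élément `ũ(f)`"). [cite: Bourbaki1989CommAlg, Ch. III §4 no. 5 Prop. 6] -/
def adicEval (I : Ideal A) {τ : Type v} (x : τ → A) (f : MvPowerSeries τ A) : A :=
  letI : WithIdeal A := ⟨I⟩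
  MvPowerSeries.eval₂ (RingHom.id A) x f

section Basic

variable (I : Ideal A) {τ : Type v} (x : τ → A)

/-- On (coercions of) polynomials, adic evaluation is polynomial evaluation. [cite: Bourbaki1989CommAlg, Ch. III §4 no. 5 Prop. 6] -/
theorem adicEval_coe (P : MvPolynomial τ A) :
    adicEval I x (P : MvPowerSeries τ A) = MvPolynomial.eval x P := by
  letI : WithIdeal A := ⟨I⟩
  show MvPowerSeries.eval₂ (RingHom.id A) x P = _
  rw [MvPowerSeries.eval₂_coe, MvPolynomial.eval₂_id]

/-- `adicEval` of a constant. [cite: Bourbaki1989CommAlg, Ch. III §4 no. 5 Prop. 6] -/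
theorem adicEval_C (c : A) : adicEval I x (C c : MvPowerSeries τ A) = c := by
  letI : WithIdeal A := ⟨I⟩
  show MvPowerSeries.eval₂ (RingHom.id A) x _ = _
  rw [MvPowerSeries.eval₂_C, RingHom.id_apply]

/-- `adicEval` of a variable. [cite: Bourbaki1989CommAlg, Ch. III §4 no. 5 Prop. 6] -/
theorem adicEval_X (s : τ) : adicEval I x (X s : MvPowerSeries τ A) = x s := by
  letI : WithIdeal A := ⟨I⟩
  show MvPowerSeries.eval₂ (RingHom.id A) x _ = _
  rw [MvPowerSeries.eval₂_X]

/-- `adicEval` of `1`. [cite: Bourbaki1989CommAlg, Ch. III §4 no. 5 Prop. 6] -/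
theorem adicEval_one : adicEval I x (1 : MvPowerSeries τ A) = 1 := by
  rw [← MvPolynomial.coe_one, adicEval_coe, map_one]

/-- `adicEval` of `0`. [cite: Bourbaki1989CommAlg, Ch. III §4 no. 5 Prop. 6] -/
theorem adicEval_zero : adicEval I x (0 : MvPowerSeries τ A) = 0 := by
  rw [← MvPolynomial.coe_zero, adicEval_coe, map_zero]

end Basic

/-! ### Monomials at points of an ideal -/

section Monomials

variable {τ : Type v}

/-- A monomial `x^e` in elements `x_s ∈ I` lies in `I^{|e|}`. [cite: Bourbaki1989CommAlg, Ch. III §4 no. 5 Prop. 6] -/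
theorem prod_pow_mem_pow_degree (I : Ideal A) {x : τ → A} (hx : ∀ s, x s ∈ I) (e : τ →₀ ℕ) :
    (e.prod fun s n => x s ^ n) ∈ I ^ e.degree := by
  rw [Finsupp.prod, Finsupp.degree_apply, ← Finset.prod_pow_eq_pow_sum]
  exact Ideal.prod_mem_prod fun s _ => Ideal.pow_mem_pow (hx s) _

/-- If `x ≡ y (mod J)` coordinatewise then `x^e ≡ y^e (mod J)`. [cite: Bourbaki1989CommAlg, Ch. III §4 no. 5 Cor. of Prop. 7] -/
theorem prod_pow_sub_prod_pow_mem (J : Ideal A) {x y : τ → A} (hxy : ∀ s, x s - y s ∈ J)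
    (e : τ →₀ ℕ) : (e.prod fun s n => x s ^ n) - (e.prod fun s n => y s ^ n) ∈ J := by
  rw [← Ideal.Quotient.eq, Finsupp.prod, Finsupp.prod, map_prod, map_prod]
  refine Finset.prod_congr rfl fun s _ => ?_
  rw [map_pow, map_pow, (Ideal.Quotient.eq).mpr (hxy s)]

/-- Second-order estimate for monomials of degree `≥ 2`: if `x, y ∈ I` coordinatewise and
`x ≡ y (mod I^r)` then `x^e ≡ y^e (mod I^{r+1})`. [cite: Bourbaki1989CommAlg, Ch. III §4 no. 5 Cor. of Prop. 7] -/
theorem prod_pow_sub_prod_pow_mem_pow_succ (I : Ideal A) {x y : τ → A} (hx : ∀ s, x s ∈ I)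
    (hy : ∀ s, y s ∈ I) {r : ℕ} (hxy : ∀ s, x s - y s ∈ I ^ r) (e : τ →₀ ℕ)
    (he : 2 ≤ e.degree) :
    (e.prod fun s n => x s ^ n) - (e.prod fun s n => y s ^ n) ∈ I ^ (r + 1) := by
  classical
  have he0 : e ≠ 0 := by
    rintro rfl
    simp at he
  obtain ⟨i, hi⟩ : ∃ i, e i ≠ 0 := by
    by_contra h
    push Not at h
    exact he0 (Finsupp.ext h)
  set e' : τ →₀ ℕ := e - Finsupp.single i 1 with he'
  have hle : Finsupp.single i 1 ≤ e := by
    rw [Finsupp.single_le_iff]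
    omega
  have hee' : e = e' + Finsupp.single i 1 := by
    rw [he', tsub_add_cancel_of_le hle]
  have hdeg : 1 ≤ e'.degree := by
    have h1 : e.degree = e'.degree + 1 := by
      conv_lhs => rw [hee']
      rw [map_add, Finsupp.degree_single]
    omega
  have hsplit : ∀ z : τ → A,
      (e.prod fun s n => z s ^ n) = (e'.prod fun s n => z s ^ n) * z i := by
    intro z
    rw [hee', Finsupp.prod_add_index' (fun _ => pow_zero _) (fun _ _ _ => pow_add _ _ _),
      Finsupp.prod_single_index (h := fun s n => z s ^ n) (pow_zero _), pow_one]
  rw [hsplit x, hsplit y]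
  have hy' : (e'.prod fun s n => y s ^ n) ∈ I :=
    Ideal.pow_le_self (by omega) (prod_pow_mem_pow_degree I hy e')
  have : (e'.prod fun s n => x s ^ n) * x i - (e'.prod fun s n => y s ^ n) * y i =
      ((e'.prod fun s n => x s ^ n) - e'.prod fun s n => y s ^ n) * x i +
        (e'.prod fun s n => y s ^ n) * (x i - y i) := by ring
  rw [this, pow_succ]
  exact Ideal.add_mem _ (Ideal.mul_mem_mul (prod_pow_sub_prod_pow_mem (I ^ r) hxy e') (hx i))
    (by rw [mul_comm (I ^ r)]; exact Ideal.mul_mem_mul hy' (hxy i))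

/-- `(d • z)^e = d^{|e|} z^e`. [cite: Bourbaki1989CommAlg, Ch. III §4 no. 5 Prop. 6] -/
theorem prod_pow_smul (d : A) (z : τ → A) (e : τ →₀ ℕ) :
    (e.prod fun s n => (d • z) s ^ n) = d ^ e.degree * e.prod fun s n => z s ^ n := by
  simp only [Pi.smul_apply, smul_eq_mul, mul_pow]
  rw [Finsupp.prod_mul, Finsupp.prod, Finset.prod_pow_eq_pow_sum, Finsupp.degree_apply]

end Monomials

/-! ### Evaluation over an adically complete ring -/

section Complete

variable (I : Ideal A) [IsAdicComplete I A] {τ : Type v} [Finite τ]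

/-- In the `I`-adic topology of an `I`-adically complete ring, the space is complete. [folklore] -/
private theorem completeSpace_withIdeal : (letI : WithIdeal A := ⟨I⟩; CompleteSpace A) := by
  letI : WithIdeal A := ⟨I⟩
  exact ((IsAdic.isAdicComplete_iff (rfl : IsAdic I)).mp ‹_›).1

/-- … and separated. [folklore] -/
private theorem t2Space_withIdeal : (letI : WithIdeal A := ⟨I⟩; T2Space A) := by
  letI : WithIdeal A := ⟨I⟩
  exact ((IsAdic.isAdicComplete_iff (rfl : IsAdic I)).mp ‹_›).2

variable {I} in
omit [IsAdicComplete I A] in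
/-- Points with coordinates in `I` are evaluable in the `I`-adic topology. [folklore] -/
private theorem hasEval_withIdeal {x : τ → A} (hx : ∀ s, x s ∈ I) :
    (letI : WithIdeal A := ⟨I⟩; MvPowerSeries.HasEval x) := by
  letI : WithIdeal A := ⟨I⟩
  haveI : Fintype τ := Fintype.ofFinite τ
  exact ⟨fun s => WithIdeal.isTopologicallyNilpotent_of_mem (hx s), by
    rw [Filter.cofinite_eq_bot]; exact Filter.tendsto_bot⟩

omit [IsAdicComplete I A] in
/-- An ideal containing a power of `I` is closed in the `I`-adic topology. [folklore] -/
private theorem isClosed_of_pow_le {J : Ideal A} {N : ℕ} (hJ : I ^ N ≤ J) :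
    (letI : WithIdeal A := ⟨I⟩; IsClosed (J : Set A)) := by
  letI : WithIdeal A := ⟨I⟩
  have hopen : IsOpen ((I ^ N : Ideal A) : Set A) := (isAdic_iff.mp (rfl : IsAdic I)).1 N
  have hJopen : IsOpen (J : Set A) :=
    AddSubgroup.isOpen_mono (H₁ := (I ^ N).toAddSubgroup) (H₂ := J.toAddSubgroup) hJ hopen
  exact AddSubgroup.isClosed_of_isOpen J.toAddSubgroup hJopen

/-- **Adic evaluation as a ring homomorphism** `A⟦X⟧ → A` at a point `x ∈ I^τ` (Mathlib's
`MvPowerSeries.eval₂Hom` in the `I`-adic topology): Bourbaki's `ũ` for `u = id`, "il existe un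
homomorphisme `ũ` et un seul de `A[[X₁,…,Xₙ]]` dans `B` tel que `ũ(a) = u(a)` … et `ũ(Xᵢ) = xᵢ`".
[cite: Bourbaki1989CommAlg, Ch. III §4 no. 5 Prop. 6] -/
def adicEvalHom (x : τ → A) (hx : ∀ s, x s ∈ I) : MvPowerSeries τ A →+* A :=
  letI : WithIdeal A := ⟨I⟩
  haveI := completeSpace_withIdeal I
  haveI := t2Space_withIdeal I
  MvPowerSeries.eval₂Hom (φ := RingHom.id A) continuous_id (hasEval_withIdeal hx)

variable {I}
variable {x y : τ → A}

/-- `adicEvalHom` is `adicEval`. [cite: Bourbaki1989CommAlg, Ch. III §4 no. 5 Prop. 6] -/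
@[simp]
theorem adicEvalHom_apply (hx : ∀ s, x s ∈ I) (f : MvPowerSeries τ A) :
    adicEvalHom I x hx f = adicEval I x f := by
  letI : WithIdeal A := ⟨I⟩
  haveI := completeSpace_withIdeal I
  haveI := t2Space_withIdeal I
  show MvPowerSeries.eval₂Hom _ _ f = MvPowerSeries.eval₂ (RingHom.id A) x f
  rw [MvPowerSeries.coe_eval₂Hom]

/-- Additivity of adic evaluation. [cite: Bourbaki1989CommAlg, Ch. III §4 no. 5 Prop. 6] -/
theorem adicEval_add (hx : ∀ s, x s ∈ I) (f g : MvPowerSeries τ A) :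
    adicEval I x (f + g) = adicEval I x f + adicEval I x g := by
  simp only [← adicEvalHom_apply hx, map_add]

/-- Adic evaluation of a difference. [cite: Bourbaki1989CommAlg, Ch. III §4 no. 5 Prop. 6] -/
theorem adicEval_sub (hx : ∀ s, x s ∈ I) (f g : MvPowerSeries τ A) :
    adicEval I x (f - g) = adicEval I x f - adicEval I x g := by
  simp only [← adicEvalHom_apply hx, map_sub]

/-- Multiplicativity of adic evaluation. [cite: Bourbaki1989CommAlg, Ch. III §4 no. 5 Prop. 6] -/
theorem adicEval_mul (hx : ∀ s, x s ∈ I) (f g : MvPowerSeries τ A) :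
    adicEval I x (f * g) = adicEval I x f * adicEval I x g := by
  simp only [← adicEvalHom_apply hx, map_mul]

/-- Adic evaluation of a finite sum. [cite: Bourbaki1989CommAlg, Ch. III §4 no. 5 Prop. 6] -/
theorem adicEval_sum (hx : ∀ s, x s ∈ I) {ι : Type*} (t : Finset ι)
    (f : ι → MvPowerSeries τ A) :
    adicEval I x (∑ i ∈ t, f i) = ∑ i ∈ t, adicEval I x (f i) := by
  simp only [← adicEvalHom_apply hx, map_sum]

/-- `adicEval (C c * f) = c * adicEval f`. [cite: Bourbaki1989CommAlg, Ch. III §4 no. 5 Prop. 6] -/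
theorem adicEval_C_mul (hx : ∀ s, x s ∈ I) (c : A) (f : MvPowerSeries τ A) :
    adicEval I x (C c * f) = c * adicEval I x f := by
  rw [adicEval_mul hx, adicEval_C]

/-- The defining convergent sum: `Σ_e f_e x^e → f(x)` in the `I`-adic topology. [folklore] -/
private theorem hasSum_adicEval (hx : ∀ s, x s ∈ I) (f : MvPowerSeries τ A) :
    (letI : WithIdeal A := ⟨I⟩;
      HasSum (fun e : τ →₀ ℕ => coeff e f * e.prod fun s n => x s ^ n) (adicEval I x f)) := by
  letI : WithIdeal A := ⟨I⟩
  haveI := completeSpace_withIdeal I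
  haveI := t2Space_withIdeal I
  have h := MvPowerSeries.hasSum_eval₂ (φ := RingHom.id A) continuous_id (hasEval_withIdeal hx) f
  unfold adicEval
  simpa only [RingHom.id_apply] using h

/-- **Termwise closed-ideal principle.** Let `J ⊇ I^N` (such an ideal is closed in the `I`-adic
topology) and `x, y ∈ I^τ`. If for every exponent `e` the difference of terms
`f_e x^e - g_e y^e` lies in `J`, then `f(x) - g(y) ∈ J`. [cite: Bourbaki1989CommAlg, Ch. III §4 no. 5 Prop. 6] -/
theorem adicEval_sub_adicEval_mem (hx : ∀ s, x s ∈ I) (hy : ∀ s, y s ∈ I)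
    (f g : MvPowerSeries τ A) {J : Ideal A} {N : ℕ} (hJ : I ^ N ≤ J)
    (h : ∀ e : τ →₀ ℕ,
      coeff e f * (e.prod fun s n => x s ^ n) - coeff e g * (e.prod fun s n => y s ^ n) ∈ J) :
    adicEval I x f - adicEval I y g ∈ J := by
  letI : WithIdeal A := ⟨I⟩
  have hsum := (hasSum_adicEval hx f).sub (hasSum_adicEval hy g)
  refine (isClosed_of_pow_le I hJ).mem_of_tendsto hsum (Filter.Eventually.of_forall fun t => ?_)
  exact J.sum_mem fun e _ => h e

/-- One-point version: if every term `f_e x^e ∈ J ⊇ I^N` then `f(x) ∈ J`. [cite: Bourbaki1989CommAlg, Ch. III §4 no. 5 Prop. 6] -/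
theorem adicEval_mem_of_forall_mem (hx : ∀ s, x s ∈ I) (f : MvPowerSeries τ A) {J : Ideal A}
    {N : ℕ} (hJ : I ^ N ≤ J) (h : ∀ e : τ →₀ ℕ, coeff e f * (e.prod fun s n => x s ^ n) ∈ J) :
    adicEval I x f ∈ J := by
  have := adicEval_sub_adicEval_mem hx hx f 0 hJ (fun e => by
    rw [map_zero, zero_mul, sub_zero]; exact h e)
  rwa [adicEval_zero, sub_zero] at this

/-- A power series with no terms of total degree `< N`, evaluated at a point of `I^τ`, takes its
value in `I^N`. [cite: Bourbaki1989CommAlg, Ch. III §4 no. 5 Prop. 6] -/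
theorem adicEval_mem_pow_of_coeff_eq_zero (hx : ∀ s, x s ∈ I) {f : MvPowerSeries τ A} {N : ℕ}
    (hf : ∀ e : τ →₀ ℕ, e.degree < N → coeff e f = 0) : adicEval I x f ∈ I ^ N := by
  refine adicEval_mem_of_forall_mem hx f le_rfl fun e => ?_
  by_cases he : e.degree < N
  · rw [hf e he, zero_mul]
    exact zero_mem _
  · exact Ideal.mul_mem_left _ _
      (Ideal.pow_le_pow_right (not_lt.mp he) (prod_pow_mem_pow_degree I hx e))

/-- **Characterisation by truncations**: `f(x) ≡ (Σ_{|e|<N} f_e X^e)(x) (mod I^N)`. [cite: Bourbaki1989CommAlg, Ch. III §4 no. 5 Prop. 6] -/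
theorem adicEval_sub_eval_truncTotal_mem_pow (hx : ∀ s, x s ∈ I) (f : MvPowerSeries τ A)
    (N : ℕ) : adicEval I x f - MvPolynomial.eval x (truncTotal N f) ∈ I ^ N := by
  rw [← adicEval_coe I x, ← adicEval_sub hx]
  refine adicEval_mem_pow_of_coeff_eq_zero hx fun e he => ?_
  rw [map_sub, MvPolynomial.coeff_coe, coeff_truncTotal _ he, sub_self]

/-- **Lipschitz in the point**: if `x ≡ y (mod J)` coordinatewise, `J ⊇ I^N`, then
`f(x) ≡ f(y) (mod J)`. [cite: Bourbaki1989CommAlg, Ch. III §4 no. 5 Cor. of Prop. 7] -/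
theorem adicEval_sub_adicEval_mem_of_sub_mem (hx : ∀ s, x s ∈ I) (hy : ∀ s, y s ∈ I)
    {J : Ideal A} {N : ℕ} (hJ : I ^ N ≤ J) (hxy : ∀ s, x s - y s ∈ J) (f : MvPowerSeries τ A) :
    adicEval I x f - adicEval I y f ∈ J :=
  adicEval_sub_adicEval_mem hx hy f f hJ fun e => by
    rw [← mul_sub]
    exact Ideal.mul_mem_left _ _ (prod_pow_sub_prod_pow_mem J hxy e)

/-- **Second-order Lipschitz estimate**: for `f` with no constant and no linear terms and
`x, y ∈ I^τ` with `x ≡ y (mod I^r)`, `f(x) ≡ f(y) (mod I^{r+1})`. [cite: Bourbaki1989CommAlg, Ch. III §4 no. 5 Cor. of Prop. 7] -/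
theorem adicEval_sub_adicEval_mem_pow_succ (hx : ∀ s, x s ∈ I) (hy : ∀ s, y s ∈ I)
    {f : MvPowerSeries τ A} (hf : ∀ e : τ →₀ ℕ, e.degree < 2 → coeff e f = 0) {r : ℕ}
    (hxy : ∀ s, x s - y s ∈ I ^ r) :
    adicEval I x f - adicEval I y f ∈ I ^ (r + 1) := by
  refine adicEval_sub_adicEval_mem hx hy f f (le_refl (I ^ (r + 1))) fun e => ?_
  by_cases he : e.degree < 2
  · rw [hf e he, zero_mul, zero_mul, sub_zero]
    exact zero_mem _
  · rw [← mul_sub]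
    exact Ideal.mul_mem_left _ _
      (prod_pow_sub_prod_pow_mem_pow_succ I hx hy hxy e (not_lt.mp he))

/-- A power series of order `≥ 2` takes values in `I²` on `I^τ` (in particular in `I`).
[cite: Bourbaki1989CommAlg, Ch. III §4 no. 5 Prop. 6] -/
theorem adicEval_mem_sq_of_coeff_eq_zero (hx : ∀ s, x s ∈ I) {f : MvPowerSeries τ A}
    (hf : ∀ e : τ →₀ ℕ, e.degree < 2 → coeff e f = 0) : adicEval I x f ∈ I ^ 2 :=
  adicEval_mem_pow_of_coeff_eq_zero hx hf

/-- `f(x) ≡ f(0) (mod I)` for `x ∈ I^τ`. [cite: Bourbaki1989CommAlg, Ch. III §4 no. 5 Cor. of Prop. 7] -/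
theorem adicEval_sub_constantCoeff_mem (hx : ∀ s, x s ∈ I) (f : MvPowerSeries τ A) :
    adicEval I x f - constantCoeff f ∈ I := by
  have h := adicEval_sub_eval_truncTotal_mem_pow hx f 1
  rw [pow_one] at h
  have htr : MvPolynomial.eval x (truncTotal 1 f) = constantCoeff f := by
    classical
    have : truncTotal 1 f = MvPolynomial.C (constantCoeff f) := by
      refine MvPolynomial.ext _ _ fun e => ?_
      rw [coeff_truncTotal_eq_ite, MvPolynomial.coeff_C]
      by_cases he : e = 0
      · subst he
        simp
      · have : ¬ e.degree < 1 := by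
          intro h1
          exact he ((Finsupp.degree_eq_zero_iff e).mp (by omega))
        rw [if_neg this, if_neg (Ne.symm he)]
    rw [this, MvPolynomial.eval_C]
  rwa [htr] at h

/-- If moreover `f(0) ∈ I` then `f(x) ∈ I`. [cite: Bourbaki1989CommAlg, Ch. III §4 no. 5 Cor. of Prop. 7] -/
theorem adicEval_mem_of_constantCoeff_mem (hx : ∀ s, x s ∈ I) {f : MvPowerSeries τ A}
    (hf : constantCoeff f ∈ I) : adicEval I x f ∈ I := by
  have := I.add_mem (adicEval_sub_constantCoeff_mem hx f) hf
  rwa [sub_add_cancel] at this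

omit [Finite τ] in
/-- Separatedness: two elements congruent modulo every power of `I` are equal. [cite: Bourbaki1989CommAlg, Ch. III §2 no. 5] -/
theorem eq_of_forall_sub_mem_pow {a b : A} (h : ∀ N : ℕ, a - b ∈ I ^ N) : a = b := by
  refine IsHausdorff.eq_iff_smodEq (I := I) |>.mpr fun N => ?_
  rw [SModEq.sub_mem, smul_eq_mul, Ideal.mul_top]
  exact h N

/-- **Rescaling**: if `f_e · d^{|e|} = d² · g_e` for every exponent `e` (e.g. `f` of order `≥ 2`
and `g_e = f_e d^{|e|-2}`), then `f(d·z) = d² · g(z)` for `z ∈ I^τ`. [cite: Bourbaki1989CommAlg, Ch. III §4 no. 5 Prop. 6] -/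
theorem adicEval_smul_eq_sq_mul (hz : ∀ s, x s ∈ I) (d : A) (f g : MvPowerSeries τ A)
    (hfg : ∀ e : τ →₀ ℕ, coeff e f * d ^ e.degree = d ^ 2 * coeff e g) :
    adicEval I (d • x) f = d ^ 2 * adicEval I x g := by
  have hdz : ∀ s, (d • x) s ∈ I := fun s => by
    rw [Pi.smul_apply, smul_eq_mul]; exact Ideal.mul_mem_left _ _ (hz s)
  refine eq_of_forall_sub_mem_pow (I := I) fun N => ?_
  rw [← adicEval_C_mul hz]
  refine adicEval_sub_adicEval_mem hdz hz f _ (le_refl (I ^ N)) fun e => ?_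
  rw [prod_pow_smul, ← mul_assoc, hfg e, coeff_C_mul, sub_self]
  exact zero_mem _

/-- **Uniqueness**: a ring homomorphism `Φ : A⟦X⟧ → A` which is polynomial evaluation at `x`
on polynomials and maps series without terms of degree `< N` into `I^N` (i.e. is continuous for
the `(X)`-adic filtration into the `I`-adic one) IS adic evaluation at `x`. [cite: Bourbaki1989CommAlg, Ch. III §4 no. 5 Prop. 6] -/
theorem ringHom_eq_adicEval (hx : ∀ s, x s ∈ I) (Φ : MvPowerSeries τ A →+* A)
    (hpoly : ∀ P : MvPolynomial τ A, Φ (P : MvPowerSeries τ A) = MvPolynomial.eval x P)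
    (hcont : ∀ (N : ℕ) (f : MvPowerSeries τ A),
      (∀ e : τ →₀ ℕ, e.degree < N → coeff e f = 0) → Φ f ∈ I ^ N)
    (f : MvPowerSeries τ A) : Φ f = adicEval I x f := by
  refine eq_of_forall_sub_mem_pow (I := I) fun N => ?_
  have h1 : Φ f - MvPolynomial.eval x (truncTotal N f) ∈ I ^ N := by
    rw [← hpoly, ← map_sub]
    refine hcont N _ fun e he => ?_
    rw [map_sub, MvPolynomial.coeff_coe, coeff_truncTotal _ he, sub_self]
  have := (I ^ N).sub_mem h1 (adicEval_sub_eval_truncTotal_mem_pow hx f N)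
  rwa [sub_sub_sub_cancel_right] at this

end Complete

/-! ### Compatibility with ring homomorphisms -/

section Map

variable {I : Ideal A} [IsAdicComplete I A] {B : Type*} [CommRing B] {I' : Ideal B}
  [IsAdicComplete I' B] {τ : Type v} [Finite τ]

/-- Coefficientwise `map` commutes with total-degree truncation. [cite: Bourbaki1989CommAlg, Ch. III §4 no. 5 Prop. 6] -/
theorem map_truncTotal (φ : A →+* B) (N : ℕ) (f : MvPowerSeries τ A) :
    MvPolynomial.map φ (truncTotal N f) = truncTotal N (MvPowerSeries.map φ f) := by
  classical
  refine MvPolynomial.ext _ _ fun e => ?_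
  rw [MvPolynomial.coeff_map, coeff_truncTotal_eq_ite, coeff_truncTotal_eq_ite,
    MvPowerSeries.coeff_map]
  split_ifs
  · rfl
  · rw [map_zero]

/-- **Base change of adic evaluation**: for a ring homomorphism `φ : A → B` with `φ(I) ⊆ I'`,
`B` complete for `I'`, and `x ∈ I^τ`: `φ (f(x)) = (φ f)(φ ∘ x)`. [cite: Bourbaki1989CommAlg, Ch. III §4 no. 5 Prop. 6] -/
theorem map_adicEval (φ : A →+* B) (hφ : I.map φ ≤ I') {x : τ → A} (hx : ∀ s, x s ∈ I)
    (f : MvPowerSeries τ A) :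
    φ (adicEval I x f) = adicEval I' (fun s => φ (x s)) (MvPowerSeries.map φ f) := by
  have hx' : ∀ s, φ (x s) ∈ I' := fun s => hφ (Ideal.mem_map_of_mem φ (hx s))
  refine eq_of_forall_sub_mem_pow (I := I') fun N => ?_
  have h1 : φ (adicEval I x f) - φ (MvPolynomial.eval x (truncTotal N f)) ∈ I' ^ N := by
    rw [← map_sub]
    have := Ideal.mem_map_of_mem φ (adicEval_sub_eval_truncTotal_mem_pow hx f N)
    rw [Ideal.map_pow] at this
    exact Ideal.pow_right_mono hφ N this
  have h2 : φ (MvPolynomial.eval x (truncTotal N f)) =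
      MvPolynomial.eval (fun s => φ (x s)) (truncTotal N (MvPowerSeries.map φ f)) := by
    rw [← map_truncTotal, MvPolynomial.eval_map, ← MvPolynomial.eval₂_id,
      MvPolynomial.eval₂_comp_left]
    rfl
  have h3 := adicEval_sub_eval_truncTotal_mem_pow hx' (MvPowerSeries.map φ f) N
  have := (I' ^ N).sub_mem h1 h3
  rw [h2] at this
  convert this using 1
  ring

end Map

end Literature.RingTheory.MvPowerSeries
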